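import Mathlib
import Summits.ValiantsHypothesis.ValiantsHypothesis.Theorems.LacunarySymmetroidDoorA26GraftSecancyInflection

/-!
# Route `LacunarySymmetroid` — crux `DoorA26` (stmt-ValiantsHypothesis-19979): SECANCY ≤ INFLECTIONS + 2 on a graph-like arc
# (the counted form of the secancy–inflection lemma: `n + 3` collinear points force `n + 1` distinct inflections)

HONEST FRAMING.  Cell `pub-symmetroid`, seat `val-sym-door-p4` (gen 12); helper file `--supports stmt-ValiantsHypothesis-19979` (`DoorA26`,
OPEN, never asserted).  Companion of `…DoorA26GraftSecancyInflection` (p690286: three zeros ⇒ one inflection, four ⇒ two) and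
`…DoorA26GraftInflectionBudget` (p689485: fewer than `C(K,3)` inflections).  This file proves the COUNTED law by induction-free bookkeeping
(choice along a chain of consecutive intervals):

* `exists_strictMono_interlace` — if between any two consecutive points of a strictly increasing chain `z₀ < ⋯ < z_{m+1}` some point satisfies
  `P`, there is a strictly increasing chain `c₀ < ⋯ < c_m` of such points, interlacing the `z`'s;
* `exists_chain_wronskian_eq_zero` — `m + 2` zeros of `H` (chart function `A ≠ 0`) give `m + 1` interlacing zeros of `A H′ − A′ H`;
* **`exists_chain_det3_eq_zero`** — on a GRAPH-LIKE arc (`A ≠ 0`, `A B′ − A′ B ≠ 0` on `[z₀, z_{n+2}]`), `n + 3` zeros `z₀ < ⋯ < z_{n+2}` of `H` force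
  `n + 1` DISTINCT zeros of the inflection determinant `det[(A,B,H); (A′,B′,H′); (A″,B″,H″)]` inside `(z₀, z_{n+2})` — i.e.
  **SECANCY ≤ INFLECTIONS + 2**;
* `exists_chain_inflections_of_collinear` — curve form: `n + 3` intersections of a graph-like arc of `W : ℝ → ℝ³` with a line force `n + 1`
  inflections `det(W, W′, W″) = 0` on the arc.

READING (graft dictionary of this seat, memo DOOR-A26-P4G12-REPORT.md, located, not asserted): the number `γ` of external roots any single graft
letter can convert at an end of a `(2,5)` pencil is the secancy of the end arc of the letter curve, hence `γ ≤ ι_end + 2` on a graph-like end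
arc; with p689485, `Σ` over disjoint graph-like arcs of `(secancy − 2)⁺ ≤ C(K,3) − 1`.  Nothing here bears on `DoorA26` / `DoorA34` (OPEN), the
registers, `MatrixDescartes` (stmt-ValiantsHypothesis-18050) or `VP ≠ VNP`.  No `def`, no `sorry`; axioms standard.  [folklore] Rolle's theorem.
-/

-- `Summit.ValiantsHypothesis.ValiantsHypothesis.…` repeats a component by the D-0017 layout
-- (single-conjunct summit), which the `dupNamespace` linter flags; the name is mandated.
set_option linter.dupNamespace false

namespace Summit.ValiantsHypothesis.ValiantsHypothesis.Theorems.LacunarySymmetroid.DoorA26.Inflection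

open Set

/-! ### 1. Choice along a chain -/

/-- **Interlacing choice.**  If `z : Fin (m+2) → ℝ` is strictly increasing and between each pair of consecutive points some point
satisfies `P`, then there is a strictly increasing `c : Fin (m+1) → ℝ` with `P (c i)` and `z i < c i < z (i+1)`. [folklore] -/
theorem exists_strictMono_interlace {m : ℕ} {z : Fin (m + 2) → ℝ} {P : ℝ → Prop}
    (h : ∀ i : Fin (m + 1), ∃ c ∈ Ioo (z i.castSucc) (z i.succ), P c) :
    ∃ c : Fin (m + 1) → ℝ, StrictMono c ∧ (∀ i, c i ∈ Ioo (z i.castSucc) (z i.succ)) ∧ ∀ i, P (c i) := by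
  choose c hc hP using h
  refine ⟨c, ?_, hc, hP⟩
  refine Fin.strictMono_iff_lt_succ.mpr fun i => ?_
  have h1 : c i.castSucc < z i.castSucc.succ := (hc i.castSucc).2
  have h2 : z i.succ.castSucc < c i.succ := (hc i.succ).1
  have : (i.castSucc.succ : Fin (m + 2)) = i.succ.castSucc := by
    ext; simp
  rw [this] at h1
  exact h1.trans h2

/-! ### 2. Chains of Wronskian zeros and of inflections -/

/-- **`m + 2` zeros of `H` give `m + 1` interlacing zeros of the Wronskian `A H′ − A′ H`** (Rolle for `H/A` on each gap;
`A ≠ 0` on the whole range). [folklore] -/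
theorem exists_chain_wronskian_eq_zero {m : ℕ} {A H A' H' : ℝ → ℝ} {z : Fin (m + 2) → ℝ} (hz : StrictMono z)
    (hA : ∀ x, HasDerivAt A (A' x) x) (hH : ∀ x, HasDerivAt H (H' x) x)
    (hA0 : ∀ x ∈ Icc (z 0) (z (Fin.last (m + 1))), A x ≠ 0) (hzero : ∀ i, H (z i) = 0) :
    ∃ c : Fin (m + 1) → ℝ, StrictMono c ∧ (∀ i, c i ∈ Ioo (z i.castSucc) (z i.succ)) ∧
      ∀ i, A (c i) * H' (c i) - A' (c i) * H (c i) = 0 := by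
  refine exists_strictMono_interlace (P := fun x => A x * H' x - A' x * H x = 0) fun i => ?_
  have hlt : z i.castSucc < z i.succ := hz (Fin.castSucc_lt_succ (i := i))
  refine exists_wronskian_eq_zero hlt hA hH (fun x hx => hA0 x ⟨?_, ?_⟩) (hzero _) (hzero _)
  · exact (hz.monotone (Fin.zero_le _)).trans hx.1
  · exact hx.2.trans (hz.monotone (Fin.le_last _))

/-- **SECANCY ≤ INFLECTIONS + 2.**  `A, B, H` twice differentiable; on `[z₀, z_{n+2}]` the chart function `A` and the Wronskian
`A B′ − A′ B` do not vanish (graph-like arc); `H` vanishes at the `n + 3` points of a strictly increasing chain `z`.  Then the inflection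
determinant `det[(A,B,H); (A′,B′,H′); (A″,B″,H″)]` has `n + 1` DISTINCT zeros (a strictly increasing chain) inside `(z₀, z_{n+2})`. [folklore] -/
theorem exists_chain_det3_eq_zero {n : ℕ} {A B H A' B' H' A'' B'' H'' : ℝ → ℝ} {z : Fin (n + 3) → ℝ} (hz : StrictMono z)
    (hA : ∀ x, HasDerivAt A (A' x) x) (hA' : ∀ x, HasDerivAt A' (A'' x) x)
    (hB : ∀ x, HasDerivAt B (B' x) x) (hB' : ∀ x, HasDerivAt B' (B'' x) x)
    (hH : ∀ x, HasDerivAt H (H' x) x) (hH' : ∀ x, HasDerivAt H' (H'' x) x)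
    (hA0 : ∀ x ∈ Icc (z 0) (z (Fin.last (n + 2))), A x ≠ 0)
    (hω : ∀ x ∈ Icc (z 0) (z (Fin.last (n + 2))), A x * B' x - A' x * B x ≠ 0)
    (hzero : ∀ i, H (z i) = 0) :
    ∃ y : Fin (n + 1) → ℝ, StrictMono y ∧ (∀ i, y i ∈ Ioo (z 0) (z (Fin.last (n + 2)))) ∧
      ∀ i, A (y i) * (B' (y i) * H'' (y i) - H' (y i) * B'' (y i)) - B (y i) * (A' (y i) * H'' (y i) - H' (y i) * A'' (y i)) +
        H (y i) * (A' (y i) * B'' (y i) - B' (y i) * A'' (y i)) = 0 := by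
  -- first chain: zeros of ω_H = A H' − A' H
  obtain ⟨c, hcmono, hcint, hc0⟩ := exists_chain_wronskian_eq_zero (m := n + 1) hz hA hH hA0 hzero
  -- the c's lie inside [z 0, z last]
  have hcI : ∀ i, c i ∈ Ioo (z 0) (z (Fin.last (n + 2))) := fun i =>
    ⟨(hz.monotone (Fin.zero_le _)).trans_lt (hcint i).1, (hcint i).2.trans_le (hz.monotone (Fin.le_last _))⟩
  -- derivatives of ω and ω_H
  have hωd : ∀ x, HasDerivAt (fun y => A y * B' y - A' y * B y)
      (A' x * B' x + A x * B'' x - (A'' x * B x + A' x * B' x)) x :=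
    fun x => ((hA x).mul (hB' x)).sub ((hA' x).mul (hB x))
  have hωHd : ∀ x, HasDerivAt (fun y => A y * H' y - A' y * H y)
      (A' x * H' x + A x * H'' x - (A'' x * H x + A' x * H' x)) x :=
    fun x => ((hA x).mul (hH' x)).sub ((hA' x).mul (hH x))
  -- second chain: Rolle for ω_H / ω between consecutive c's
  obtain ⟨y, hymono, hyint, hy0⟩ := exists_chain_wronskian_eq_zero (m := n) (A := fun t => A t * B' t - A' t * B t)
    (H := fun t => A t * H' t - A' t * H t) hcmono hωd hωHd
    (fun x hx => hω x ⟨(hcI 0).1.le.trans hx.1, hx.2.trans (hcI (Fin.last _)).2.le⟩) hc0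
  have hyI : ∀ i, y i ∈ Ioo (z 0) (z (Fin.last (n + 2))) := fun i =>
    ⟨(hcI _).1.trans (hyint i).1, (hyint i).2.trans (hcI _).2⟩
  refine ⟨y, hymono, hyI, fun i => ?_⟩
  have hAy : A (y i) ≠ 0 := hA0 _ (Ioo_subset_Icc_self (hyI i))
  have key : (A (y i) * B' (y i) - A' (y i) * B (y i)) * (A (y i) * H'' (y i) - A'' (y i) * H (y i)) -
      (A (y i) * B'' (y i) - A'' (y i) * B (y i)) * (A (y i) * H' (y i) - A' (y i) * H (y i)) = 0 := by
    have e1 : A' (y i) * H' (y i) + A (y i) * H'' (y i) - (A'' (y i) * H (y i) + A' (y i) * H' (y i)) =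
        A (y i) * H'' (y i) - A'' (y i) * H (y i) := by ring
    have e2 : A' (y i) * B' (y i) + A (y i) * B'' (y i) - (A'' (y i) * B (y i) + A' (y i) * B' (y i)) =
        A (y i) * B'' (y i) - A'' (y i) * B (y i) := by ring
    have h0 := hy0 i
    rw [e1, e2] at h0
    linarith [h0]
  rw [wronskian_identity] at key
  rcases mul_eq_zero.mp key with h | h
  · exact absurd h hAy
  · exact h

/-! ### 3. Curve form -/

open Matrix

/-- **`n + 3` collinear points on a graph-like arc force `n + 1` inflections.**  `W : ℝ → ℝ³` with componentwise derivatives `W′, W″`;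
independent functionals `α, β, η` (`det[α;β;η] ≠ 0`); on `[z₀, z_{n+2}]` the chart functional `α·W` and the Wronskian of `(α·W, β·W)` do not
vanish; the arc meets the line `{η = 0}` at the `n + 3` points of the chain `z`.  Then `det(W, W′, W″)` vanishes at `n + 1` distinct points of
`(z₀, z_{n+2})`. [folklore] -/
theorem exists_chain_inflections_of_collinear {n : ℕ} {W W' W'' : ℝ → Fin 3 → ℝ} (α β η : Fin 3 → ℝ)
    {z : Fin (n + 3) → ℝ} (hz : StrictMono z)
    (hW : ∀ i x, HasDerivAt (fun y => W y i) (W' x i) x) (hW' : ∀ i x, HasDerivAt (fun y => W' y i) (W'' x i) x)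
    (hL : Matrix.det (Matrix.of ![α, β, η]) ≠ 0)
    (hA0 : ∀ x ∈ Icc (z 0) (z (Fin.last (n + 2))), α ⬝ᵥ W x ≠ 0)
    (hω : ∀ x ∈ Icc (z 0) (z (Fin.last (n + 2))), (α ⬝ᵥ W x) * (β ⬝ᵥ W' x) - (α ⬝ᵥ W' x) * (β ⬝ᵥ W x) ≠ 0)
    (hzero : ∀ i, η ⬝ᵥ W (z i) = 0) :
    ∃ y : Fin (n + 1) → ℝ, StrictMono y ∧ (∀ i, y i ∈ Ioo (z 0) (z (Fin.last (n + 2)))) ∧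
      ∀ i, Matrix.det (Matrix.of ![W (y i), W' (y i), W'' (y i)]) = 0 := by
  obtain ⟨y, hymono, hyI, hy0⟩ := exists_chain_det3_eq_zero (A := fun t => α ⬝ᵥ W t) (B := fun t => β ⬝ᵥ W t)
    (H := fun t => η ⬝ᵥ W t) (A' := fun t => α ⬝ᵥ W' t) (B' := fun t => β ⬝ᵥ W' t) (H' := fun t => η ⬝ᵥ W' t)
    (A'' := fun t => α ⬝ᵥ W'' t) (B'' := fun t => β ⬝ᵥ W'' t) (H'' := fun t => η ⬝ᵥ W'' t) hz
    (fun x => hasDerivAt_dotProduct α x fun i => hW i x) (fun x => hasDerivAt_dotProduct α x fun i => hW' i x)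
    (fun x => hasDerivAt_dotProduct β x fun i => hW i x) (fun x => hasDerivAt_dotProduct β x fun i => hW' i x)
    (fun x => hasDerivAt_dotProduct η x fun i => hW i x) (fun x => hasDerivAt_dotProduct η x fun i => hW' i x)
    hA0 hω hzero
  refine ⟨y, hymono, hyI, fun i => ?_⟩
  have h := hy0 i
  rw [det3_pairings_eq] at h
  rcases mul_eq_zero.mp h with h' | h'
  · exact absurd h' hL
  · exact h'

end Summit.ValiantsHypothesis.ValiantsHypothesis.Theorems.LacunarySymmetroid.DoorA26.Inflection
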